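import Summits.Ventures.PercRepro.OneEdgeMonoAB

/-!
# PercRepro — C-026 on a minor-closed family: the family induction (p1, gen 5; lead (jk)(6), INBOX 2341)

Steps 0–1 of mine-3's proof of «C-026 on hub graphs» (`proofs/MINE3-HUB-theorem.md`), for ANY family of
marked multigraphs closed under marked minors with distinct marks: the reduction of C-026 at every `p` on
the family to the class positivity of `kernel26` on its REDUCED members (simple, three distinct marks, no
`a–b` edge).  The plain hub family is p5's theorem `c026_hub` (C026Hub.lean, unconditional, with its own
induction); this generic file serves the extended families of Theorem′ / Theorem″ (`C026HubFamilyExt.lean`: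
the neighbourhood of one mark hub-like, the rest arbitrary), for which the reduced class positivity is the
remaining content.

* **`MarkedFamily`**, **`MarkedFamily.MinorClosed`** (closed under every marked minor whose three new marks
  are distinct), **`MarkedFamily.ReducedClassPositive`** (the «after Step 1» hypothesis);
* **`cubeSumQuad_kernel26_nonneg_of_family`** — strong induction on the number of edges over the whole
  family: repeated marks (p5's `cubeSumQuad_kernel26_nonneg_of_not_injective`), a loop (`cubeSumQuad_loop`:
  `CS = 2·CS(G − e)`), a parallel pair (`cubeSumQuad_parallel`: `CS = CS(G − e′) + 2·CS(G/e − e′)`), an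
  `a–b` edge (`cubeSumQuad_deleteEdge_eq_of_isABEdge`: `CS = CS(G − e)`) — the smaller graphs being marked
  minors in the family — else the hypothesis;
* **`c026_of_family`** — hence, by the antipodal principle (`quadForm_nonneg_of_minors`), C-026 at every
  `p ∈ [0,1]^E` on every member of the family.
-/
namespace PercRepro

open Finset

/-! ### Families of marked multigraphs -/

/-- A family of marked multigraphs: a predicate on every finite marked multigraph. -/
def MarkedFamily : Type 1 :=
  ∀ {V E : Type} [Fintype E] [DecidableEq E], MultiGraph V E → V → V → V → Prop

/-- The family is closed under every marked minor whose three new marks are distinct. -/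
def MarkedFamily.MinorClosed (P : MarkedFamily) : Prop :=
  ∀ {V E : Type} [Fintype E] [DecidableEq E] (G : MultiGraph V E) (a b c : V) (u v : Config E),
    P G a b c → Function.Injective ![G.sureClass v a, G.sureClass v b, G.sureClass v c] →
      P (G.minor u v) (G.sureClass v a) (G.sureClass v b) (G.sureClass v c)

/-- **The reduced hypothesis**: the class sum of `kernel26` is nonnegative on every REDUCED member of the
family — simple (no loops, no parallel edges), three distinct marks, no `a–b` edge. -/
def MarkedFamily.ReducedClassPositive (P : MarkedFamily) : Prop :=
  ∀ {V E : Type} [Fintype V] [Fintype E] [DecidableEq E] (G : MultiGraph V E) (a b c : V),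
    P G a b c → G.IsSimple → a ≠ b → a ≠ c → b ≠ c → (∀ e, ¬ G.IsABEdge a b e) →
      0 ≤ G.cubeSumQuad ![a, b, c] kernel26

namespace MultiGraph

variable {V E : Type*} (G : MultiGraph V E) [Fintype E] [DecidableEq E]

omit [Fintype E] [DecidableEq E] in
/-- The marks of a minor, as a vector. -/
theorem sureClass_marks (v : Config E) (a b c : V) :
    (fun i => G.sureClass v (![a, b, c] i)) = ![G.sureClass v a, G.sureClass v b, G.sureClass v c] := by
  funext i
  fin_cases i <;> rfl

/-- `CS(G − e)` is the class sum of the minor «`e` deleted» (through `cubeSumDel`). -/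
theorem cubeSumQuad_deleteEdge_eq_minorQuad (e : E) (a b c : V) :
    (G.deleteEdge e).cubeSumQuad ![a, b, c] kernel26 =
      (G.minor (fun x => decide (x ≠ e)) ⊥).cubeSumQuad
        ![G.sureClass ⊥ a, G.sureClass ⊥ b, G.sureClass ⊥ c] kernel26 := by
  rw [G.cubeSumQuad_deleteEdge, G.cubeSumDel_eq_minorQuad, G.sureClass_marks]

end MultiGraph

/-! ### The family induction -/

/-- The class sum of a minor with possibly repeated marks, from the family hypothesis: repeated marks by
p5's lemma, distinct marks by the induction hypothesis (the family is minor-closed). -/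
theorem MarkedFamily.minor_nonneg (P : MarkedFamily) (hP : P.MinorClosed) {V E : Type} [Fintype E]
    [DecidableEq E] {G : MultiGraph V E} {a b c : V} (hG : P G a b c) (u v : Config E)
    [Fintype (Quotient (G.connSetoid v))]
    (ih : ∀ (a' b' c' : Quotient (G.connSetoid v)), P (G.minor u v) a' b' c' →
      0 ≤ (G.minor u v).cubeSumQuad ![a', b', c'] kernel26) :
    0 ≤ (G.minor u v).cubeSumQuad ![G.sureClass v a, G.sureClass v b, G.sureClass v c] kernel26 := by
  by_cases hinj : Function.Injective ![G.sureClass v a, G.sureClass v b, G.sureClass v c]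
  · exact ih _ _ _ (hP G a b c u v hG hinj)
  · exact (G.minor u v).cubeSumQuad_kernel26_nonneg_of_not_injective _ hinj

/-- **Class positivity of `kernel26` on the whole family, given it on the reduced members** (strong
induction on the number of edges; the reductions are exact identities, the smaller graphs marked minors). -/
theorem cubeSumQuad_kernel26_nonneg_of_family (P : MarkedFamily) (hP : P.MinorClosed)
    (h : P.ReducedClassPositive) (n : ℕ) :
    ∀ {V E : Type} [Fintype V] [Fintype E] [DecidableEq E], Fintype.card E = n →
      ∀ (G : MultiGraph V E) (a b c : V), P G a b c → 0 ≤ G.cubeSumQuad ![a, b, c] kernel26 := by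
  induction n using Nat.strong_induction_on with
  | _ n ih =>
    intro V E _ _ _ hn G a b c hG
    classical
    -- repeated marks
    by_cases hinj : Function.Injective ![a, b, c]
    swap
    · exact G.cubeSumQuad_kernel26_nonneg_of_not_injective _ hinj
    have hab : a ≠ b := fun h' => absurd (hinj (show ![a, b, c] 0 = ![a, b, c] 1 from h')) (by decide)
    have hac : a ≠ c := fun h' => absurd (hinj (show ![a, b, c] 0 = ![a, b, c] 2 from h')) (by decide)
    have hbc : b ≠ c := fun h' => absurd (hinj (show ![a, b, c] 1 = ![a, b, c] 2 from h')) (by decide)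
    -- a loop: `CS = 2·CS(G − e)`
    by_cases hl : ∃ e, G.fst e = G.snd e
    · obtain ⟨e, he⟩ := hl
      rw [G.cubeSumQuad_loop he, G.cubeSumDel_eq_minorQuad, G.sureClass_marks]
      have hlt : Fintype.card (Face (fun x => decide (x ≠ e)) (⊥ : Config E)) < n := by
        rw [← hn]
        exact Fintype.card_subtype_lt (x := e) (by simp)
      have := P.minor_nonneg hP hG (fun x => decide (x ≠ e)) ⊥ fun a' b' c' h' =>
        ih _ hlt rfl _ a' b' c' h'
      linarith
    -- a parallel pair: `CS = CS(G − e′) + 2·CS(G/e − e′)`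
    by_cases hp : ∃ e e', G.Parallel e e' ∧ e ≠ e'
    · obtain ⟨e, e', hpar, hne⟩ := hp
      rw [G.cubeSumQuad_parallel hne hpar, G.cubeSumDel_eq_minorQuad,
        G.cubeSumDelCon_eq_minorQuad _ _ hne, G.sureClass_marks, G.sureClass_marks]
      have hlt₁ : Fintype.card (Face (fun x => decide (x ≠ e')) (⊥ : Config E)) < n := by
        rw [← hn]
        exact Fintype.card_subtype_lt (x := e') (by simp)
      have hlt₂ : Fintype.card (Face (fun x => decide (x ≠ e')) (fun x => decide (x = e))) < n := by
        rw [← hn]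
        exact Fintype.card_subtype_lt (x := e') (by simp)
      have h₁ := P.minor_nonneg hP hG (fun x => decide (x ≠ e')) ⊥ fun a' b' c' h' =>
        ih _ hlt₁ rfl _ a' b' c' h'
      have h₂ := P.minor_nonneg hP hG (fun x => decide (x ≠ e')) (fun x => decide (x = e))
        fun a' b' c' h' => ih _ hlt₂ rfl _ a' b' c' h'
      linarith
    -- an `a–b` edge: `CS = CS(G − e)`
    by_cases hab' : ∃ e, G.IsABEdge a b e
    · obtain ⟨e, he⟩ := hab'
      rw [← G.cubeSumQuad_deleteEdge_eq_of_isABEdge he, G.cubeSumQuad_deleteEdge_eq_minorQuad]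
      have hlt : Fintype.card (Face (fun x => decide (x ≠ e)) (⊥ : Config E)) < n := by
        rw [← hn]
        exact Fintype.card_subtype_lt (x := e) (by simp)
      exact P.minor_nonneg hP hG (fun x => decide (x ≠ e)) ⊥ fun a' b' c' h' =>
        ih _ hlt rfl _ a' b' c' h'
    -- reduced: the hypothesis
    · push Not at hl hp hab'
      exact h G a b c hG ⟨hl, hp⟩ hab hac hbc hab'

/-- **C-026 at every `p ∈ [0,1]^E` on every member of a minor-closed family, given the reduced class
positivity** — by the antipodal principle: every face of the edge cube has a nonnegative class sum. The
inequality is C-026 in its `law3` form `P(a~b)·P(c ≁ a ∧ c ≁ b) ≤ P(ab|c) + P(ac|b) + P(bc|a)`. -/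
theorem c026_of_family (P : MarkedFamily) (hP : P.MinorClosed) (h : P.ReducedClassPositive)
    {V E : Type} [Fintype V] [Fintype E] [DecidableEq E] (G : MultiGraph V E) {a b c : V}
    (hG : P G a b c) (p : E → ℝ) (hp : IsProb p) :
    (G.law3 p a b c 0 + G.law3 p a b c 1) * (G.law3 p a b c 1 + G.law3 p a b c 4) ≤
      G.law3 p a b c 1 + G.law3 p a b c 2 + G.law3 p a b c 3 := by
  have key := G.quadForm_nonneg_of_minors hp ![a, b, c] kernel26 fun u v _ => by
    classical
    rw [G.sureClass_marks]
    exact P.minor_nonneg hP hG u v fun a' b' c' h' =>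
      cubeSumQuad_kernel26_nonneg_of_family P hP h _ rfl _ a' b' c' h'
  rw [G.quadForm_kernel26] at key
  linarith

end PercRepro
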